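import Summits.Ventures.Crystal3D.Theorems.StickyWulffConstantCoaxialWallLawModuleContactsTable
import Summits.Ventures.Crystal3D.Theorems.StickyWulffConstantCoaxialWallLawLatticeContactsBridge
import HarnessLib

/-!
# FOUR BARLOW CONTACTS FORCE A MODULE POINT, II: the real bridge (crux `CoaxialWallLaw`, stmt-Ventures-19481, line `WallLedgerF`;
# rigidity lemma of the line of `stub_multiGrainSmallHigh`)

HONEST FRAMING. Venture `Summits/Ventures/Crystal3D` (cell `crystal3d-full`), helper `--supports` the crux `CoaxialWallLaw` of
`route-Ventures-StickyWulffConstant` (REGISTERED line `WallLedgerF`, skeleton 'CoaxialWallLawCertificates' v4, stub `stub_multiGrainSmallHigh`).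
Rung credit only; F-C1 not moved; census-free.  Sequel of `…ModuleContactsTable` (kernel `check`/`table` in integer module coordinates, rows `D m`,
`D = diag(3,1,2)`, module sphere `Q(u) = 12`): the REAL ALGEBRA turning a passing `check a b c` plus the real contact equations into `u ∈ S18`:
* `QZ_le_48`, `QZ_sub_le_48` — contact vectors have `Q ≤ 48` and are pairwise `≤ 2` apart; `ne_of_sep`;
* `cramer_eq`, **`exists_menu_of_fullCheck`** — full rank: `2d·u = W`, `Q(W) = 48d²`, `W ∈ 2d·S18 ⇒ u ∈ S18`;
* `QZ_pos` (+ `LatticeContacts.dotZ_self_pos`, `LatticeContacts.gramDet_eq`), **`rank2_structure`** — rank two: every real solution of the two independent row equations on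
  the module sphere is `2G·v = P₀ + s (Dp × Dq)` with `coefA s² + coefB s + coefC = 0`; `solves_real`; **`exists_menu_of_rank2Check`** — the kernel's
  consistency / discriminant / root-count data leave `u` equal to one of the unit module vectors found (Vieta for the two-root case).
WHAT THIS IS NOT: not the core theorem (`…ModuleContacts`), not the geometry (`…ModuleContactsBarlow`); F-C1 not moved.
-/

noncomputable section

namespace Summit.Ventures.Crystal3D.Theorems

namespace ModuleContacts

open Summit.Ventures.Crystal3D Finset
open LatticeContacts (dotR)
open scoped InnerProductSpace

/-! ### §2 The real bridge (rows `D m`, module sphere `Q(u) = 12`) -/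

section Bridge

variable {u0 u1 u2 : ℝ}

/-- A contact vector has `Q ≤ 48` (`Q(2u − m) ≥ 0`). -/
theorem QZ_le_48 (hu : 3 * u0 ^ 2 + u1 ^ 2 + 2 * u2 ^ 2 = 12) {a : V3}
    (ha : 2 * dotR u0 u1 u2 (rowZ a) = (QZ a : ℝ)) : QZ a ≤ 48 := by
  have h : ((QZ a : ℤ) : ℝ) ≤ 48 := by
    simp only [dotR, rowZ, QZ] at ha ⊢; push_cast at ha ⊢
    nlinarith [sq_nonneg (2 * u0 - a.1), sq_nonneg (2 * u1 - a.2.1), sq_nonneg (2 * u2 - a.2.2)]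
  exact_mod_cast h

/-- Two contact vectors are at most `2` apart: `Q(a − b) ≤ 48`. -/
theorem QZ_sub_le_48 (hu : 3 * u0 ^ 2 + u1 ^ 2 + 2 * u2 ^ 2 = 12) {a b : V3}
    (ha : 2 * dotR u0 u1 u2 (rowZ a) = (QZ a : ℝ)) (hb : 2 * dotR u0 u1 u2 (rowZ b) = (QZ b : ℝ)) :
    QZ (subZ a b) ≤ 48 := by
  have h : ((QZ (subZ a b) : ℤ) : ℝ) ≤ 48 := by
    simp only [dotR, rowZ, QZ, subZ] at ha hb ⊢; push_cast at ha hb ⊢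
    nlinarith [sq_nonneg ((u0 - a.1) + (u0 - b.1)), sq_nonneg ((u1 - a.2.1) + (u1 - b.2.1)),
      sq_nonneg ((u2 - a.2.2) + (u2 - b.2.2))]
  exact_mod_cast h

/-- Separated vectors are distinct. -/
theorem ne_of_sep {a b : V3} (h : 12 ≤ QZ (subZ a b)) : a ≠ b := by
  rintro rfl; simp [QZ, subZ] at h

/-- **Cramer on the rows**: `2d·u = W` componentwise, `d = Da·(Db × Dc)`, `W = cramerW a b c`. -/
theorem cramer_eq {a b c : V3} (ha : 2 * dotR u0 u1 u2 (rowZ a) = (QZ a : ℝ))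
    (hb : 2 * dotR u0 u1 u2 (rowZ b) = (QZ b : ℝ)) (hc : 2 * dotR u0 u1 u2 (rowZ c) = (QZ c : ℝ)) :
    2 * (dotZ (rowZ a) (crossZ (rowZ b) (rowZ c)) : ℝ) * u0 = ((cramerW a b c).1 : ℝ) ∧
    2 * (dotZ (rowZ a) (crossZ (rowZ b) (rowZ c)) : ℝ) * u1 = ((cramerW a b c).2.1 : ℝ) ∧
    2 * (dotZ (rowZ a) (crossZ (rowZ b) (rowZ c)) : ℝ) * u2 = ((cramerW a b c).2.2 : ℝ) := by
  simp only [dotR, dotZ, crossZ, cramerW, addZ, smulZ, rowZ] at ha hb hc ⊢; push_cast at ha hb hc ⊢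
  refine ⟨?_, ?_, ?_⟩
  · linear_combination ((b.2.1 : ℝ) * (2 * c.2.2) - 2 * b.2.2 * c.2.1) * ha +
      ((c.2.1 : ℝ) * (2 * a.2.2) - 2 * c.2.2 * a.2.1) * hb + ((a.2.1 : ℝ) * (2 * b.2.2) - 2 * a.2.2 * b.2.1) * hc
  · linear_combination ((2 * (b.2.2 : ℝ)) * (3 * c.1) - 3 * b.1 * (2 * c.2.2)) * ha +
      ((2 * (c.2.2 : ℝ)) * (3 * a.1) - 3 * c.1 * (2 * a.2.2)) * hb + ((2 * (a.2.2 : ℝ)) * (3 * b.1) - 3 * a.1 * (2 * b.2.2)) * hc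
  · linear_combination ((3 * (b.1 : ℝ)) * c.2.1 - b.2.1 * (3 * c.1)) * ha + ((3 * (c.1 : ℝ)) * a.2.1 - c.2.1 * (3 * a.1)) * hb +
      ((3 * (a.1 : ℝ)) * b.2.1 - a.2.1 * (3 * b.1)) * hc

/-- **Full rank**: the kernel's `fullCheck` and the real equations put `u` on a unit module vector. -/
theorem exists_menu_of_fullCheck {a b c : V3} (hd : dotZ (rowZ a) (crossZ (rowZ b) (rowZ c)) ≠ 0)
    (h : fullCheck a b c (dotZ (rowZ a) (crossZ (rowZ b) (rowZ c))) = true) (hu : 3 * u0 ^ 2 + u1 ^ 2 + 2 * u2 ^ 2 = 12)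
    (ha : 2 * dotR u0 u1 u2 (rowZ a) = (QZ a : ℝ)) (hb : 2 * dotR u0 u1 u2 (rowZ b) = (QZ b : ℝ))
    (hc : 2 * dotR u0 u1 u2 (rowZ c) = (QZ c : ℝ)) :
    ∃ σ ∈ S18, u0 = (σ.1 : ℝ) ∧ u1 = (σ.2.1 : ℝ) ∧ u2 = (σ.2.2 : ℝ) := by
  set d := dotZ (rowZ a) (crossZ (rowZ b) (rowZ c)) with hd'
  set W := cramerW a b c with hW
  obtain ⟨e0, e1, e2⟩ := cramer_eq (u0 := u0) (u1 := u1) (u2 := u2) ha hb hc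
  rw [← hd', ← hW] at e0 e1 e2
  have hnorm : QZ W = 48 * d * d := by
    have h' : ((QZ W : ℤ) : ℝ) = 48 * d * d := by
      simp only [QZ]; push_cast
      rw [← e0, ← e1, ← e2]
      linear_combination (4 * (d : ℝ) ^ 2) * hu
    exact_mod_cast h'
  unfold fullCheck at h
  rw [Bool.or_eq_true] at h
  rcases h with h | h
  · exact absurd hnorm (by simpa [bne_iff_ne] using h)
  · obtain ⟨σ, hσ, hσW⟩ := List.any_eq_true.1 h
    rw [beq_iff_eq] at hσW
    have hdR : (2 : ℝ) * d ≠ 0 := mul_ne_zero two_ne_zero (by exact_mod_cast hd)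
    refine ⟨σ, hσ, ?_, ?_, ?_⟩
    · apply mul_left_cancel₀ hdR
      have := congrArg Prod.fst hσW; simp only [smulZ] at this
      rw [e0, ← this]; push_cast; ring
    · apply mul_left_cancel₀ hdR
      have := congrArg (fun x => x.2.1) hσW; simp only [smulZ] at this
      rw [e1, ← this]; push_cast; ring
    · apply mul_left_cancel₀ hdR
      have := congrArg (fun x => x.2.2) hσW; simp only [smulZ] at this
      rw [e2, ← this]; push_cast; ring

/-- A nonzero integer vector has positive `Q`. -/
theorem QZ_pos (n : V3) (hn : n ≠ (0, 0, 0)) : 0 < QZ n := by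
  obtain ⟨x, y, z⟩ := n
  simp only [QZ]
  have hne : ¬ (x = 0 ∧ y = 0 ∧ z = 0) := by
    rintro ⟨rfl, rfl, rfl⟩; exact hn rfl
  rcases ne_or_eq x 0 with hx | hx
  · nlinarith [sq_nonneg y, sq_nonneg z, sq_pos_of_ne_zero hx]
  rcases ne_or_eq y 0 with hy | hy
  · nlinarith [sq_nonneg x, sq_nonneg z, sq_pos_of_ne_zero hy]
  rcases ne_or_eq z 0 with hz | hz
  · nlinarith [sq_nonneg x, sq_nonneg y, sq_pos_of_ne_zero hz]
  · exact absurd ⟨hx, hy, hz⟩ hne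

/-- **Rank two, structure of the real solutions**: with the rows `rp = Dp`, `rq = Dq` independent, every real `v` with `Q(v) = 12`,
`2 rp·v = Q(p)`, `2 rq·v = Q(q)` satisfies `2G v = P₀ + s (rp × rq)` for a real root `s` of `coefA s² + coefB s + coefC = 0`. -/
theorem rank2_structure {p q : V3} (hn : crossZ (rowZ p) (rowZ q) ≠ (0, 0, 0)) {v0 v1 v2 : ℝ}
    (hv : 3 * v0 ^ 2 + v1 ^ 2 + 2 * v2 ^ 2 = 12)
    (hp : 2 * dotR v0 v1 v2 (rowZ p) = (QZ p : ℝ)) (hq : 2 * dotR v0 v1 v2 (rowZ q) = (QZ q : ℝ)) :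
    ∃ s : ℝ, (2 * (gramDet (rowZ p) (rowZ q) : ℝ) * v0 = ((P0 p q).1 : ℝ) + s * ((crossZ (rowZ p) (rowZ q)).1 : ℝ) ∧
      2 * (gramDet (rowZ p) (rowZ q) : ℝ) * v1 = ((P0 p q).2.1 : ℝ) + s * ((crossZ (rowZ p) (rowZ q)).2.1 : ℝ) ∧
      2 * (gramDet (rowZ p) (rowZ q) : ℝ) * v2 = ((P0 p q).2.2 : ℝ) + s * ((crossZ (rowZ p) (rowZ q)).2.2 : ℝ)) ∧
      (coefA p q : ℝ) * s ^ 2 + (coefB p q : ℝ) * s + (coefC p q : ℝ) = 0 := by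
  set rp := rowZ p with hrp
  set rq := rowZ q with hrq
  have hlag : gramDet rp rq = dotZ (crossZ rp rq) (crossZ rp rq) := LatticeContacts.gramDet_eq rp rq
  have hGpos : 0 < gramDet rp rq := by rw [hlag]; exact LatticeContacts.dotZ_self_pos _ hn
  have hG : (gramDet rp rq : ℝ) ≠ 0 := by exact_mod_cast hGpos.ne'
  set G : ℝ := (gramDet rp rq : ℝ) with hGdef
  set n0 : ℝ := ((crossZ rp rq).1 : ℝ) with hn0
  set n1 : ℝ := ((crossZ rp rq).2.1 : ℝ) with hn1
  set n2 : ℝ := ((crossZ rp rq).2.2 : ℝ) with hn2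
  set P00 : ℝ := ((P0 p q).1 : ℝ) with hP00
  set P01 : ℝ := ((P0 p q).2.1 : ℝ) with hP01
  set P02 : ℝ := ((P0 p q).2.2 : ℝ) with hP02
  set w0 : ℝ := 2 * G * v0 - P00 with hw0
  set w1 : ℝ := 2 * G * v1 - P01 with hw1
  set w2 : ℝ := 2 * G * v2 - P02 with hw2
  -- `P₀ · rp = G Q(p)`, `P₀ · rq = G Q(q)` (integer identities), hence `w ⊥ rp, rq`
  have hP0p : ((dotZ (P0 p q) rp : ℤ) : ℝ) = ((gramDet rp rq * QZ p : ℤ) : ℝ) := by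
    have : dotZ (P0 p q) rp = gramDet rp rq * QZ p := by
      simp only [P0, ← hrp, ← hrq, gramDet, dotZ, addZ, smulZ]; ring
    exact_mod_cast this
  have hP0q : ((dotZ (P0 p q) rq : ℤ) : ℝ) = ((gramDet rp rq * QZ q : ℤ) : ℝ) := by
    have : dotZ (P0 p q) rq = gramDet rp rq * QZ q := by
      simp only [P0, ← hrp, ← hrq, gramDet, dotZ, addZ, smulZ]; ring
    exact_mod_cast this
  have hwp : w0 * rp.1 + w1 * rp.2.1 + w2 * rp.2.2 = 0 := by
    simp only [dotZ] at hP0p; push_cast at hP0p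
    simp only [dotR] at hp
    rw [hw0, hw1, hw2, hP00, hP01, hP02, hGdef]
    linear_combination (gramDet rp rq : ℝ) * hp - hP0p
  have hwq : w0 * rq.1 + w1 * rq.2.1 + w2 * rq.2.2 = 0 := by
    simp only [dotZ] at hP0q; push_cast at hP0q
    simp only [dotR] at hq
    rw [hw0, hw1, hw2, hP00, hP01, hP02, hGdef]
    linear_combination (gramDet rp rq : ℝ) * hq - hP0q
  -- `BAC − CAB`: `|n|² w = (w·n) n`
  have hGn : G = n0 * n0 + n1 * n1 + n2 * n2 := by
    rw [hGdef, hlag, hn0, hn1, hn2]; simp only [dotZ]; push_cast; ring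
  have e0 : n0 = (rp.2.1 : ℝ) * rq.2.2 - rp.2.2 * rq.2.1 := by rw [hn0]; simp only [crossZ]; push_cast; ring
  have e1 : n1 = (rp.2.2 : ℝ) * rq.1 - rp.1 * rq.2.2 := by rw [hn1]; simp only [crossZ]; push_cast; ring
  have e2 : n2 = (rp.1 : ℝ) * rq.2.1 - rp.2.1 * rq.1 := by rw [hn2]; simp only [crossZ]; push_cast; ring
  set s : ℝ := (w0 * n0 + w1 * n1 + w2 * n2) / G with hs
  have hw0' : w0 = s * n0 := by
    rw [hs, div_mul_eq_mul_div, eq_div_iff hG, hGn, e0, e1, e2]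
    linear_combination ((((rp.2.2 : ℝ) * rq.1 - rp.1 * rq.2.2) * rp.2.2 - ((rp.1 : ℝ) * rq.2.1 - rp.2.1 * rq.1) * rp.2.1)) * hwq -
      ((((rp.2.2 : ℝ) * rq.1 - rp.1 * rq.2.2) * rq.2.2 - ((rp.1 : ℝ) * rq.2.1 - rp.2.1 * rq.1) * rq.2.1)) * hwp
  have hw1' : w1 = s * n1 := by
    rw [hs, div_mul_eq_mul_div, eq_div_iff hG, hGn, e0, e1, e2]
    linear_combination ((((rp.1 : ℝ) * rq.2.1 - rp.2.1 * rq.1) * rp.1 - ((rp.2.1 : ℝ) * rq.2.2 - rp.2.2 * rq.2.1) * rp.2.2)) * hwq -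
      ((((rp.1 : ℝ) * rq.2.1 - rp.2.1 * rq.1) * rq.1 - ((rp.2.1 : ℝ) * rq.2.2 - rp.2.2 * rq.2.1) * rq.2.2)) * hwp
  have hw2' : w2 = s * n2 := by
    rw [hs, div_mul_eq_mul_div, eq_div_iff hG, hGn, e0, e1, e2]
    linear_combination ((((rp.2.1 : ℝ) * rq.2.2 - rp.2.2 * rq.2.1) * rp.2.1 - ((rp.2.2 : ℝ) * rq.1 - rp.1 * rq.2.2) * rp.1)) * hwq -
      ((((rp.2.1 : ℝ) * rq.2.2 - rp.2.2 * rq.2.1) * rq.2.1 - ((rp.2.2 : ℝ) * rq.1 - rp.1 * rq.2.2) * rq.1)) * hwp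
  have f0 : 2 * G * v0 = P00 + s * n0 := by linear_combination hw0'
  have f1 : 2 * G * v1 = P01 + s * n1 := by linear_combination hw1'
  have f2 : 2 * G * v2 = P02 + s * n2 := by linear_combination hw2'
  refine ⟨s, ⟨f0, f1, f2⟩, ?_⟩
  -- the module sphere: `Q(2G v) = 48 G²`, `Q(P₀ + s n)` expanded
  have hsph : 3 * (2 * G * v0) ^ 2 + (2 * G * v1) ^ 2 + 2 * (2 * G * v2) ^ 2 = 48 * G ^ 2 := by
    linear_combination (4 * G ^ 2) * hv
  rw [f0, f1, f2] at hsph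
  have hA : (coefA p q : ℝ) = 3 * n0 ^ 2 + n1 ^ 2 + 2 * n2 ^ 2 := by
    rw [hn0, hn1, hn2]; simp only [coefA, ← hrp, ← hrq, QZ]; push_cast; ring
  have hB : (coefB p q : ℝ) = 2 * (3 * P00 * n0 + P01 * n1 + 2 * P02 * n2) := by
    rw [hP00, hP01, hP02, hn0, hn1, hn2]; simp only [coefB, ← hrp, ← hrq, ipD]; push_cast; ring
  have hC : (coefC p q : ℝ) = 3 * P00 ^ 2 + P01 ^ 2 + 2 * P02 ^ 2 - 48 * G ^ 2 := by
    rw [hP00, hP01, hP02, hGdef]; simp only [coefC, ← hrp, ← hrq, QZ]; push_cast; ring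
  rw [hA, hB, hC]
  linear_combination hsph

/-- A unit module vector solving the three integer equations solves the real ones. -/
theorem solves_real {p q t σ : V3} (h : solves p q t σ = true) (hσ : σ ∈ S18) :
    3 * ((σ.1 : ℝ)) ^ 2 + ((σ.2.1 : ℝ)) ^ 2 + 2 * ((σ.2.2 : ℝ)) ^ 2 = 12 ∧
    2 * dotR (σ.1 : ℝ) (σ.2.1 : ℝ) (σ.2.2 : ℝ) (rowZ p) = (QZ p : ℝ) ∧
    2 * dotR (σ.1 : ℝ) (σ.2.1 : ℝ) (σ.2.2 : ℝ) (rowZ q) = (QZ q : ℝ) ∧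
    2 * dotR (σ.1 : ℝ) (σ.2.1 : ℝ) (σ.2.2 : ℝ) (rowZ t) = (QZ t : ℝ) := by
  simp only [solves, Bool.and_eq_true, beq_iff_eq] at h
  obtain ⟨⟨h1, h2⟩, h3⟩ := h
  have h0 := S18_Q σ hσ
  simp only [QZ, ipD] at h0 h1 h2 h3
  refine ⟨?_, ?_, ?_, ?_⟩
  · have : (((3 * σ.1 * σ.1 + σ.2.1 * σ.2.1 + 2 * σ.2.2 * σ.2.2 : ℤ)) : ℝ) = 12 := by exact_mod_cast h0
    push_cast at this; linear_combination this
  · have e : ((2 * (3 * σ.1 * p.1 + σ.2.1 * p.2.1 + 2 * σ.2.2 * p.2.2) : ℤ) : ℝ) = ((3 * p.1 * p.1 + p.2.1 * p.2.1 + 2 * p.2.2 * p.2.2 : ℤ) : ℝ) := by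
      exact_mod_cast h1
    simp only [dotR, rowZ, QZ]; push_cast at e ⊢; linear_combination e
  · have e : ((2 * (3 * σ.1 * q.1 + σ.2.1 * q.2.1 + 2 * σ.2.2 * q.2.2) : ℤ) : ℝ) = ((3 * q.1 * q.1 + q.2.1 * q.2.1 + 2 * q.2.2 * q.2.2 : ℤ) : ℝ) := by
      exact_mod_cast h2
    simp only [dotR, rowZ, QZ]; push_cast at e ⊢; linear_combination e
  · have e : ((2 * (3 * σ.1 * t.1 + σ.2.1 * t.2.1 + 2 * σ.2.2 * t.2.2) : ℤ) : ℝ) = ((3 * t.1 * t.1 + t.2.1 * t.2.1 + 2 * t.2.2 * t.2.2 : ℤ) : ℝ) := by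
      exact_mod_cast h3
    simp only [dotR, rowZ, QZ]; push_cast at e ⊢; linear_combination e

/-- **Rank two**: the kernel's `rank2Check` (independent rows of `p, q`; third vector `t`) and the real equations put `u` on a unit module vector. -/
theorem exists_menu_of_rank2Check {p q t : V3} (hn : crossZ (rowZ p) (rowZ q) ≠ (0, 0, 0)) (h : rank2Check p q t = true)
    (hu : 3 * u0 ^ 2 + u1 ^ 2 + 2 * u2 ^ 2 = 12) (hp : 2 * dotR u0 u1 u2 (rowZ p) = (QZ p : ℝ))
    (hq : 2 * dotR u0 u1 u2 (rowZ q) = (QZ q : ℝ)) (ht : 2 * dotR u0 u1 u2 (rowZ t) = (QZ t : ℝ)) :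
    ∃ σ ∈ S18, u0 = (σ.1 : ℝ) ∧ u1 = (σ.2.1 : ℝ) ∧ u2 = (σ.2.2 : ℝ) := by
  have hGpos : 0 < gramDet (rowZ p) (rowZ q) := by
    have hlag : gramDet (rowZ p) (rowZ q) = dotZ (crossZ (rowZ p) (rowZ q)) (crossZ (rowZ p) (rowZ q)) :=
      LatticeContacts.gramDet_eq _ _
    rw [hlag]; exact LatticeContacts.dotZ_self_pos _ hn
  have hG : (0 : ℝ) < (gramDet (rowZ p) (rowZ q) : ℝ) := by exact_mod_cast hGpos
  have hApos : (0 : ℝ) < (coefA p q : ℝ) := by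
    have := QZ_pos _ hn; simp only [coefA]; exact_mod_cast this
  unfold rank2Check at h
  split_ifs at h with h1 h2 h3 h4
  · -- the third equation is inconsistent with the first two
    exfalso
    push Not at h1
    have e1 := congrArg Prod.fst h1
    have e2 := congrArg (fun x => x.2.1) h1
    have e3 := congrArg (fun x => x.2.2) h1
    simp only [smulZ, addZ] at e1 e2 e3
    apply h2
    have key : ((gramDet (rowZ p) (rowZ q) * QZ t : ℤ) : ℝ) =
        ((alphaZ (rowZ p) (rowZ q) (rowZ t) * QZ p + betaZ (rowZ p) (rowZ q) (rowZ t) * QZ q : ℤ) : ℝ) := by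
      have e1' := congrArg (Int.cast (R := ℝ)) e1
      have e2' := congrArg (Int.cast (R := ℝ)) e2
      have e3' := congrArg (Int.cast (R := ℝ)) e3
      push_cast at e1' e2' e3' ⊢
      rw [← ht, ← hp, ← hq]
      simp only [dotR]
      linear_combination (2 * u0) * e1' + (2 * u1) * e2' + (2 * u2) * e3'
    exact_mod_cast key
  · -- negative discriminant: no real root
    exfalso
    obtain ⟨s, -, hs⟩ := rank2_structure hn hu hp hq
    have hd : (disc p q : ℝ) < 0 := by exact_mod_cast h3
    simp only [disc] at hd; push_cast at hd
    nlinarith [sq_nonneg (2 * (coefA p q : ℝ) * s + (coefB p q : ℝ)), hApos]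
  · -- zero discriminant: the double root is a unit module vector
    have hlen : 1 ≤ (sols p q t).length := of_decide_eq_true h
    obtain ⟨σ, hσmem⟩ := List.exists_mem_of_length_pos (l := sols p q t) (by omega)
    obtain ⟨hσS, hsol⟩ := List.mem_filter.1 hσmem
    obtain ⟨hσn, hσp, hσq, -⟩ := solves_real hsol hσS
    obtain ⟨s, ⟨e0, e1, e2⟩, hs⟩ := rank2_structure hn hu hp hq
    obtain ⟨s', ⟨f0, f1, f2⟩, hs'⟩ := rank2_structure hn hσn hσp hσq
    have hd0 : (disc p q : ℝ) = 0 := by exact_mod_cast h4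
    simp only [disc] at hd0; push_cast at hd0
    -- both are the double root `−B/(2A)`
    have hroot : ∀ x : ℝ, (coefA p q : ℝ) * x ^ 2 + (coefB p q : ℝ) * x + (coefC p q : ℝ) = 0 →
        2 * (coefA p q : ℝ) * x + (coefB p q : ℝ) = 0 := by
      intro x hx
      have : (2 * (coefA p q : ℝ) * x + (coefB p q : ℝ)) ^ 2 = 0 := by nlinarith [hx, hd0]
      exact pow_eq_zero_iff (n := 2) (by norm_num) |>.1 this
    have hss' : s = s' := by
      have a1 := hroot s hs; have a2 := hroot s' hs'
      have : 2 * (coefA p q : ℝ) * (s - s') = 0 := by linear_combination a1 - a2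
      rcases mul_eq_zero.1 this with h' | h'
      · exact absurd h' (by positivity)
      · linarith
    subst hss'
    have h2G : (2 : ℝ) * (gramDet (rowZ p) (rowZ q) : ℝ) ≠ 0 := by positivity
    refine ⟨σ, hσS, ?_, ?_, ?_⟩
    · apply mul_left_cancel₀ h2G; rw [e0, f0]
    · apply mul_left_cancel₀ h2G; rw [e1, f1]
    · apply mul_left_cancel₀ h2G; rw [e2, f2]
  · -- positive discriminant: the two roots are the two unit module vectors found
    have hlen : (sols p q t).length = 2 := of_decide_eq_true h
    obtain ⟨σ₁, σ₂, hl⟩ := List.length_eq_two.1 hlen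
    have hnd : (sols p q t).Nodup := S18_nodup.filter _
    rw [hl] at hnd
    have hne : σ₁ ≠ σ₂ := by
      intro heq; rw [heq] at hnd; exact (List.nodup_cons.1 hnd).1 (List.mem_singleton.2 rfl)
    have hm1 : σ₁ ∈ sols p q t := by rw [hl]; simp
    have hm2 : σ₂ ∈ sols p q t := by rw [hl]; simp
    obtain ⟨h1S, h1sol⟩ := List.mem_filter.1 hm1
    obtain ⟨h2S, h2sol⟩ := List.mem_filter.1 hm2
    obtain ⟨h1n, h1p, h1q, -⟩ := solves_real h1sol h1S
    obtain ⟨h2n, h2p, h2q, -⟩ := solves_real h2sol h2S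
    obtain ⟨s, ⟨e0, e1, e2⟩, hs⟩ := rank2_structure hn hu hp hq
    obtain ⟨s₁, ⟨f0, f1, f2⟩, hs₁⟩ := rank2_structure hn h1n h1p h1q
    obtain ⟨s₂, ⟨g0, g1, g2⟩, hs₂⟩ := rank2_structure hn h2n h2p h2q
    have h2G : (2 : ℝ) * (gramDet (rowZ p) (rowZ q) : ℝ) ≠ 0 := by positivity
    have hs12 : s₁ ≠ s₂ := by
      intro heq
      apply hne
      have a0 : (σ₁.1 : ℝ) = σ₂.1 := by apply mul_left_cancel₀ h2G; rw [f0, g0, heq]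
      have a1 : (σ₁.2.1 : ℝ) = σ₂.2.1 := by apply mul_left_cancel₀ h2G; rw [f1, g1, heq]
      have a2 : (σ₁.2.2 : ℝ) = σ₂.2.2 := by apply mul_left_cancel₀ h2G; rw [f2, g2, heq]
      exact Prod.ext (by exact_mod_cast a0) (Prod.ext (by exact_mod_cast a1) (by exact_mod_cast a2))
    -- Vieta: `A(s₁ + s₂) + B = 0`, and `s` is a root, so `s = s₁` or `s = s₂`
    have hsum : (coefA p q : ℝ) * (s₁ + s₂) + (coefB p q : ℝ) = 0 := by
      have : (s₁ - s₂) * ((coefA p q : ℝ) * (s₁ + s₂) + (coefB p q : ℝ)) = 0 := by linear_combination hs₁ - hs₂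
      rcases mul_eq_zero.1 this with h' | h'
      · exact absurd (sub_eq_zero.1 h') hs12
      · exact h'
    have hfac : (coefA p q : ℝ) * (s - s₁) * (s - s₂) = 0 := by
      linear_combination hs - hs₁ + (s₁ - s) * hsum
    rcases mul_eq_zero.1 hfac with h' | h'
    · rcases mul_eq_zero.1 h' with h'' | h''
      · exact absurd h'' hApos.ne'
      · have hss : s = s₁ := sub_eq_zero.1 h''
        refine ⟨σ₁, h1S, ?_, ?_, ?_⟩
        · apply mul_left_cancel₀ h2G; rw [e0, f0, hss]
        · apply mul_left_cancel₀ h2G; rw [e1, f1, hss]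
        · apply mul_left_cancel₀ h2G; rw [e2, f2, hss]
    · have hss : s = s₂ := sub_eq_zero.1 h'
      refine ⟨σ₂, h2S, ?_, ?_, ?_⟩
      · apply mul_left_cancel₀ h2G; rw [e0, g0, hss]
      · apply mul_left_cancel₀ h2G; rw [e1, g1, hss]
      · apply mul_left_cancel₀ h2G; rw [e2, g2, hss]

end Bridge

end ModuleContacts

end Summit.Ventures.Crystal3D.Theorems

end
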